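import Summits.AnomalousDissipation.AnomalousDissipation.Theorems.SolenoidalFractalHomogenisationLagrangianStepCellClauseModDefs
import Summits.AnomalousDissipation.AnomalousDissipation.Theorems.SolenoidalFractalHomogenisationLagrangianStepFlatBilinearSlow
import Literature.Analysis.FluidPDE.LagrangianLatticeCarrier
import HarnessLib

/-!
# K1L_D (stmt-AnomalousDissipation-27980), §9z glue v2: the two HYPOTHESIS TEXTS of `cellInputs_BIL_of` — `FrameConjugacyAt` (Z7α as consumed)
# and `cellInputs_alphaBeta_text` (Summits-side definitions file; review lane; lead-k1l-onelevel-p1 g5)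

Text of record: `Cruxes/LagrangianRenormalisationStep/Lines/onelevel_Z7_glue.lean` v2 (commit 6afd2a85caf7), BLESSED by the tenure planner
(RULING D26-15, 2026-08-29T03:41:53Z) after memo L12 (`Lines/onelevel-L12-glue-v2.md`); certifier's answers p5 g14 03:42:28Z.  These are the
objects the glue `cellInputs_BIL_of : (V ⇒ V_modEC) → cellInputs_alphaBeta_text → §9z` consumes; the glue's proof files are `…Z7GlueBookkeeping`
(p694305), `…Z7GlueCompose` (p694610), `…Z7GlueEulerian`, `…Z7Glue`.  DEFINITIONS ONLY — nothing is proved here; providing `cellInputs_alphaBeta_text`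
is the work of L5-0 (flow geometry: `IsModulation` of the frame), L5-3′ (frame equivalence of weak solutions ⇒ `IsDistortedPropagator` for the
conjugates + the conjugacy identities) and L6 (Eulerian coarse PDE package ⇒ (N1)(N1*)(N2)); AD is not proved; no stub is closed; rung F-D1.A0.

* `FrameConjugacyAt W M hM c Φ Cα ϱ E m S Um1 Um s t` — on ONE refresh piece `[s,t]` starting at a frame reset: a modulation datum `G` with the
  DECAY LINKS `θ ≤ Cα·E.θ(m+1)`, `nC ≤ ϱ·E.N m`, distorted propagators `Ut` (cell member, = frame conjugate of the true `Um1`) and `Tt` (coarse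
  member, = frame conjugate of `Um`; units check memo L12 §1: `Tad := Um`), reading maps `ι, ι'`, and for weakly divergence-free data the conjugacy
  `⟪(Um1 − Um)(s,t)x, y⟫ = ⟪(Ut − Tt)(0, a(t−s))(ιx), ι'y⟫` with the two loss identities;
* `cellInputs_alphaBeta_text` — §9z's binders; per grid window `[jR, s′]`: (α₁) `FrameConjugacyAt` on `[jR,(j+1)R]`, (α₂) on `[(j+1)R, s′]` when
  non-degenerate, (N1)/(N1*) the N-conversion of `lossFwd/lossAdj (Um jR s′)`, (N2) loss-rate monotonicity across `(j+1)R`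
  (`Cmono = e^{2·strain}`-type, p5 03:42:28Z (3); abstract core `LossCurrency.loss_later_le_of_expBound`, p693776).
-/

set_option linter.dupNamespace false  -- the summit-side namespace `Summit.AnomalousDissipation.AnomalousDissipation.…` repeats a component by design (D-0017)

noncomputable section

namespace Summit.AnomalousDissipation.AnomalousDissipation.Theorems.SolenoidalFractalHomogenisation.LagrangianStep.Z7Glue

open Literature.Analysis Literature.Analysis.FluidPDE Literature.Analysis.FunctionSpaces
open MeasureTheory Set Filter UnitAddTorus
open scoped ENNReal NNReal InnerProductSpace
open Literature.Analysis.FluidPDE.LatticeShear (LagrangianLatticeCarrier LatticeWord)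
open Summit.AnomalousDissipation.AnomalousDissipation.Theorems.SolenoidalFractalHomogenisation.LagrangianStep.CellClauseMod

/-- **Z7α as the glue consumes it (v2), on one refresh piece `[s, t]` starting at a frame reset** (`s` a multiple of `refresh (m+1)`,
`t − s ≤ refresh (m+1)`).  In the Lagrangian frame of the coarse flow `X m · s` (identity at `s`), in CELL time `τ = a(m+1)·(t' − s) ∈ [0, a(t−s)]`:
a modulation datum `G` (= the inverse Jacobian of the frame) with distortion `θ ≤ Cα·θ(m+1)` and modulation wavenumber `nC ≤ ϱ·N m`
(the decay links), the frame conjugates `Ut` of the TRUE propagator `Um1` (cell member: drift `cellField`, tensor `(1/n²)(ν•S)`) and `Tt` of the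
COARSE propagator `Um` (coarse member: no drift, tensor `(1/n²)(ν•S + (c/ν)Φν((1/ν)(ν•S)))`) as distorted propagators, and the reading maps
`ι, ι' : V2 → V2` (at `s`: the identity on solenoidal data; at `t`: composition with the measure-preserving `X m t s`) with, for weakly
divergence-free `x, y`: `⟪Um1 s t x − Um s t x, y⟫ = ⟪(Ut − Tt)(0, a(t−s))(ι x), ι' y⟫`, `lossFwd (Tt 0 (a(t−s))) (ι x) = lossFwd (Um s t) x`,
`lossAdj (Tt 0 (a(t−s))) (ι' y) = lossAdj (Um s t) y` (frame readings are unitary).  What the provider (L5-0 flow geometry + L5-3 α-facts +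
Lions/uniqueness for the distorted class) must deliver. -/
def FrameConjugacyAt {k : ℕ} (W : LatticeWord k) (M : ℝ) (hM : 0 < M) (c : ℝ) (Φ : ℝ → Torus.Visc4 (Fin 3) → Torus.Visc4 (Fin 3))
    (Cα ϱ : ℝ) (E : LagrangianLatticeCarrier k) (m : ℕ) (S : Torus.Visc4 (Fin 3)) (Um1 Um : ℝ → ℝ → (V2 →L[ℝ] V2)) (s t : ℝ) : Prop :=
  ∃ hν : E.cellVisc (m + 1) ∈ Set.Ioo 0 (E.cellVisc (m + 1) + 1),
  ∃ θ : ℝ, 0 ≤ θ ∧ θ ≤ Cα * E.θ (m + 1) ∧ ∃ nC : ℝ, 0 ≤ nC ∧ nC ≤ ϱ * E.N m ∧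
  ∃ G : ℝ → UnitAddTorus (Fin 3) → Matrix (Fin 3) (Fin 3) ℝ, IsModulation θ (E.a (m + 1) * (t - s)) nC G ∧
  ∃ Ut Tt : ℝ → ℝ → (V2 →L[ℝ] V2),
    IsDistortedPropagator (E.a (m + 1) * (t - s)) ((1 / (E.N (m + 1) : ℝ) ^ 2) • (E.cellVisc (m + 1) • S))
      (cellField W M hM (E.cellVisc (m + 1)) hν.1 (E.N (m + 1))) G Ut ∧
    IsDistortedPropagator (E.a (m + 1) * (t - s)) ((1 / (E.N (m + 1) : ℝ) ^ 2) • (E.cellVisc (m + 1) • S +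
      (c / E.cellVisc (m + 1)) • Φ (E.cellVisc (m + 1)) ((1 / E.cellVisc (m + 1)) • (E.cellVisc (m + 1) • S)))) (fun _ _ => 0) G Tt ∧
  ∃ ι ι' : V2 → V2,
    (∀ x y : V2, Torus.IsWeaklyDivFree (⇑x : VF) → Torus.IsWeaklyDivFree (⇑y : VF) →
      ⟪Um1 s t x - Um s t x, y⟫_ℝ
        = ⟪Ut 0 (E.a (m + 1) * (t - s)) (ι x) - Tt 0 (E.a (m + 1) * (t - s)) (ι x), ι' y⟫_ℝ) ∧
    (∀ x : V2, Torus.IsWeaklyDivFree (⇑x : VF) → lossFwd (Tt 0 (E.a (m + 1) * (t - s))) (ι x) = lossFwd (Um s t) x) ∧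
    (∀ y : V2, Torus.IsWeaklyDivFree (⇑y : VF) → lossAdj (Tt 0 (E.a (m + 1) * (t - s))) (ι' y) = lossAdj (Um s t) y)

/-- **The αβ hypothesis of the glue, v2** (§9z's binders minus `ηz ε`; `R = refresh (m+1)`, `r₁ = (j+1)R`): per grid window `[jR, s′]`,
(α₁) frame conjugacy on the full piece `[jR, r₁]`, (α₂) on the post-refresh piece `[r₁, s′]` when it is non-degenerate,
(N1)/(N1*) the N-CONVERSION of the coarse window map's two losses on the full window (Dirichlet-form monotonicity along the coarse drift;
v1 text verbatim), and (N2) the loss-rate monotonicity of the coarse flow across `r₁` (prepared data lose at most `Cmono·(τ₂/R)` of what they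
lost on the first piece). -/
def cellInputs_alphaBeta_text : Prop :=
 ∀ k (W : Literature.Analysis.FluidPDE.LatticeShear.LatticeWord k) (M : ℝ) (hM : 0 < M) (c : ℝ), 0 < c →
    ∀ (Φ : ℝ → Torus.Visc4 (Fin 3) → Torus.Visc4 (Fin 3)) (lo hi Λ β σ C ν₀ K Cf νf Kf : ℝ),
      0 < lo → lo ≤ 1 → 1 ≤ hi → 1 < Λ → 0 ≤ β →
      0 < σ → 0 ≤ C → 0 < ν₀ → 0 < K → SlowVectorClauseF W M hM c Φ lo hi Λ β σ C ν₀ K →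
      0 ≤ Cf → 0 < νf → 0 < Kf → CellEnergyClausesW W M hM c lo hi Λ β Cf νf Kf →
      (∀ Kb : ℝ, 1 ≤ Kb → ∃ CK : ℝ, 1 ≤ CK ∧ ∃ cK > (0:ℝ), ∃ νh > (0:ℝ), HighLabelDecayW W M hM lo hi Λ β νh Kb CK cK) →
      ∃ ν₁ > (0:ℝ), ∃ K₁ > (0:ℝ), ∃ Λ₀ : ℕ, ∃ θ₀ > (0:ℝ), ∃ Cα > (0:ℝ), ∃ ϱ > (0:ℝ), ∃ CN > (0:ℝ), ∃ Cmono > (0:ℝ),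
        ∀ E : Literature.Analysis.FluidPDE.LatticeShear.LagrangianLatticeCarrier k, E.design = W.stretch M hM → E.gain = c → E.nu0 ≤ ν₁ → K₁ ≤ E.K →
          E.LPermissible → E.Regular → (∀ m, Λ₀ * E.N m ≤ E.N (m + 1)) → (∀ m, E.N m ^ 2 ≤ E.N (m + 1)) →
          (∀ m, E.cellVisc (m + 1) * ((E.N (m + 1) : ℝ) / E.N m) ^ (1 / 4 : ℝ) ≤ 1) →
          (∀ m, E.K * ((E.N (m + 1) : ℝ) / E.N m) ^ (1 / 4 : ℝ) ≤ ((E.N (m + 1) : ℝ) / E.N m) * E.cellVisc (m + 1)) →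
          (∀ m, E.θ (m + 1) * ((E.N (m + 1) : ℝ) / E.N m) ^ (1 / 16 : ℝ) ≤ θ₀) →
          (∀ m, ((E.N (m + 1) : ℝ) / E.N m) ^ (1 / 16 : ℝ) * E.physPeriod (m + 1) ≤ E.refresh (m + 1)) →
        ∃ mstar : ℕ, ∀ m, mstar ≤ m →
          ∀ Lc : ℕ, Lc = ⌊((E.N m : ℝ) / E.N (m + 1)) ^ (1 / 64 : ℝ) * (E.N (m + 1) * E.cellVisc (m + 1)) / Real.sqrt c⌋₊ →
          ∀ S : Torus.Visc4 (Fin 3), Torus.OddSmall S β → Torus.NearIso S lo hi →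
            Torus.OddSmall (Φ (E.cellVisc (m + 1)) S) β → Torus.NearIso (Φ (E.cellVisc (m + 1)) S) lo hi →
          ∀ Um Um1 : ℝ → ℝ → (V2 →L[ℝ] V2),
            Torus.IsPropagator 1 (E.partialSum m) (E.kbar m • renormStep (Φ (E.cellVisc (m + 1))) (E.gain / E.cellVisc (m + 1) ^ 2) S) Um →
            Torus.IsPropagator 1 (E.partialSum (m + 1)) (E.kbar (m + 1) • S) Um1 →
          ∀ Sf : Finset (Fin 3 → ℤ), Sf = (Torus.freqBall (Lc / 2)).erase 0 →
          ∀ (j : ℕ) (s' : ℝ), (j : ℝ) * E.refresh (m + 1) + E.refresh (m + 1) ≤ s' →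
            s' ≤ (j : ℝ) * E.refresh (m + 1) + 2 * E.refresh (m + 1) → s' ≤ 1 →
            -- (α₁) frame conjugacy on the full refresh piece `[jR, (j+1)R]`
            FrameConjugacyAt W M hM c Φ Cα ϱ E m S Um1 Um ((j : ℝ) * E.refresh (m + 1)) (((j : ℝ) + 1) * E.refresh (m + 1)) ∧
            -- (α₂) frame conjugacy on the post-refresh piece `[(j+1)R, s']` (only asked when non-degenerate)
            (((j : ℝ) + 1) * E.refresh (m + 1) < s' →
              FrameConjugacyAt W M hM c Φ Cα ϱ E m S Um1 Um (((j : ℝ) + 1) * E.refresh (m + 1)) s') ∧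
            -- (N1) / (N1*) N-conversion of the coarse window map's forward / adjoint loss on the full window `[jR, s']`
            (∀ x : V2, lossFwd (Um ((j : ℝ) * E.refresh (m + 1)) s') x ≤ CN *
               (∑ k' ∈ Sf, min 1 ((E.a (m + 1) * (8 * Real.pi ^ 2 * ‖Torus.latticeVec k'‖ ^ 2 * lo * (E.cellVisc (m + 1) + c / E.cellVisc (m + 1)) / (E.N (m + 1) : ℝ) ^ 2)) * (s' - (j : ℝ) * E.refresh (m + 1))) * ‖UnitAddTorus.mFourierCoeff (EuclideanSpace.complexify ∘ ⇑(x)) k'‖ ^ 2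
                    + (‖x‖ ^ 2 - ∑ k' ∈ Sf, ‖UnitAddTorus.mFourierCoeff (EuclideanSpace.complexify ∘ ⇑(x)) k'‖ ^ 2))) ∧
            (∀ y : V2, lossAdj (Um ((j : ℝ) * E.refresh (m + 1)) s') y ≤ CN *
               (∑ k' ∈ Sf, min 1 ((E.a (m + 1) * (8 * Real.pi ^ 2 * ‖Torus.latticeVec k'‖ ^ 2 * lo * (E.cellVisc (m + 1) + c / E.cellVisc (m + 1)) / (E.N (m + 1) : ℝ) ^ 2)) * (s' - (j : ℝ) * E.refresh (m + 1))) * ‖UnitAddTorus.mFourierCoeff (EuclideanSpace.complexify ∘ ⇑(y)) k'‖ ^ 2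
                    + (‖y‖ ^ 2 - ∑ k' ∈ Sf, ‖UnitAddTorus.mFourierCoeff (EuclideanSpace.complexify ∘ ⇑(y)) k'‖ ^ 2))) ∧
            -- (N2) loss-rate monotonicity of the coarse flow across the refresh boundary `r₁ = (j+1)R`
            (∀ x : V2, lossFwd (Um (((j : ℝ) + 1) * E.refresh (m + 1)) s') (Um ((j : ℝ) * E.refresh (m + 1)) (((j : ℝ) + 1) * E.refresh (m + 1)) x)
               ≤ Cmono * ((s' - ((j : ℝ) + 1) * E.refresh (m + 1)) / E.refresh (m + 1))
                 * lossFwd (Um ((j : ℝ) * E.refresh (m + 1)) (((j : ℝ) + 1) * E.refresh (m + 1))) x)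

end Summit.AnomalousDissipation.AnomalousDissipation.Theorems.SolenoidalFractalHomogenisation.LagrangianStep.Z7Glue

end
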